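import Summits.Ventures.YMGap.RobustBall.MassGapOnBallMassive
import Summits.Ventures.YMGap.RobustBall.RowsSUN
import Summits.Ventures.YMGap.RobustBall.RowsSU3Free
import Summits.Ventures.YMGap.RobustBall.TorusRowsSU2
import Summits.Ventures.YMGap.RobustBall.RobustAreaLawRows
import Summits.Ventures.YMGap.RobustBall.RowsS
import Summits.Ventures.YMGap.RobustBall.AreaLawTierTwoNoGo
import HarnessLib

/-!
# Venture statement — YMGap (cell `pub-ymgap`) — CONJUNCT BODIES for the v1.5 append of `Statement.lean` (T22–T28):
track Y2 ROBUST-BALL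

HONEST FRAMING. WHAT THIS IS: bodies `Tk_… : Prop` + witnesses `Tk_…_holds` of seven conjuncts of the venture
statement (index of record: `Summits/Ventures/YMGap/Statement.lean`, append-only; from v1.3 on the bodies live in
per-version block files; PLAN R200). Every parent file is ACCEPTED and built; every `_holds` closes by tree
constants. T29 is RESERVED (the track-Y4 YM₃ sentence, held for v1.6 by R200).
T22–T28 are kernel-checked statements about lattice `SU(N)` Yang–Mills at STRONG COUPLING with the Wilson action
replaced by any member of a TYPED BALL of gauge-invariant perturbations (track Y2, «ROBUST-BALL»): the tier-1 `ℤ⁴`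
ball `RobustBall.MemBallZd ε₀ ε₁ R` (continuous adapted link potentials of range `R`, oscillation load `≤ ε₀`,
cross-Lipschitz load `≤ ε₁` at every link — reads incidence), the torus balls `RobustBall.ClusterDomainFR ε₀ ε₁ r`
(finite range `r`, SITE incidence) and `RobustBall.ClusterDomain κ ε₀ ε₁` (tier 2: no range cut-off, loads
weighted by `e^{κ·diam}`), and the tier-2 `ℤ⁴` ball `RobustBall.MemBallZdS a Λ t` (no range cut-off, cross load
weighted by `e^{t‖e−y‖_∞}`). Every `(β⋆_W, ε)` below is where a DOOR (a one-link Dobrushin / Poincaré bound fed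
through the Dobrushin–Shlosman or Durhuus–Fröhlich machinery) is certified to close — an artefact of the bound,
NOT the extent of a phase; `ε(β⋆) → 0` at each door's Wilson threshold. T22–T27 carry NO hypothesis; T28 is a
NEGATIVE theorem (a refuted strengthening).
* **T22** `SU(2)`, `d = 4`, tier-1 `ℤ⁴` ball: (i) the door `6|β_W| e^{ε₀} + e^{ε₀/2} √(2/3) ε₁ < 1 ⇒
  MassGapOnBallZd 4 2 (β_W/4) ε₀ ε₁ R` (every member: one DLR state + exponential clustering; rb-p1);
  (ii) the same door ⇒ every member HAS DLR states and EVERY one is massive (Osterwalder–Seiler clustering of all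
  bounded local observables) with plaquette–plaquette decay (ds-3); (iii) the rows of record
  `(β_W, ε) = (1/8, 0.143), (1/6, 0.049)` (sharp-variance door) and `(1/16, 0.294)`, radii `(2ε, ε)`, every `R`.
* **T23** every `N ≥ 1`, `d = 4`: the CONVERSION `MassGapOnBallZd 4 N β ε₀ ε₁ R ⇒` every member has DLR states,
  all massive with plaquette–plaquette decay (ds-3).
* **T24** `N ≥ 3` on the `ℤ⁴` ball, HYPOTHESIS-FREE: every `N ≥ 2`, `MassGapOnBallZd 4 N (1/64) (1/10) (1/10) R`
  ('t Hooft `1/64`, radii `(1/10, 1/10)` — NOT the `(2ε, ε)` convention; p2); `SU(3)` rows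
  `(β_W, ε) = (1/10, 0.23), (1/8, 0.16), (1/6, 0.05)` (engine-2; the larger certified-pair rows are T19's business).
* **T25** `SU(2)`, `d = 4`, TORUS balls, uniform in `L ≥ 3`: (i) quarter door `rhoFR 2 (9β_W/2) ε₀ ε₁ < 1`,
  `0 < β_W ≤ 2/3` ⇒ `TorusClusteringOnBall 2 4 (β_W/2) ε₀ ε₁ r 16 (−log ρ/(r ⊔ 1))`; (ii) row `(1/8, 0.13)` every
  range `r`; (iii) tier 2: `rhoFR 2 (e^{κ} 9β_W/2) ε₀ ε₁ < 1 ⇒ TorusClusteringOnBallW 2 4 (β_W/2) κ ε₀ ε₁ 16 κ`;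
  (iv) tier-2 row `(1/8, κ = log(6/5), ε = 43/500)` (ds-2).
* **T26** `SU(2)`, `d = 4`, AREA LAW on the torus ball (vertical window `mv ≥ 1`, every range `r`): (i) the slab
  door `e^{ε₀}(1 + 2√2 ε₁)(3β_W/2) + √2 ε₁ < 1`, `0 ≤ β_W ≤ 2/3` ⇒ `AreaLawOnBall 2 4 (β_W/2) ε₀ ε₁ r mv`; (ii) rows
  `(β_W, ε) = (1/3, 1/10)`, `(1/2, 1/25)` (rb-p2; printed Wilson threshold `1/6`).
* **T27** `SU(2)`, `d = 4`, TIER-2 `ℤ⁴` ball (no range cut-off): (i) `t > 0`,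
  `6|β_W| e^{a} e^{t} + e^{a/2} √(2/3) Λ < 1 ⇒ MassGapOnBallZdS 4 2 (β_W/4) a Λ t`; (ii) rows at weight `e^{t} = 2`:
  `(1/16, 0.097)`, `(1/16, 0.143)` (sharp variance), and at `e^{t} = 3/2`: `(1/16, 0.186)` (rb-p1).
* **T28** NEGATIVE (lit-1): the area law uniform on the TIER-2 torus ball under centre-slab invariance ALONE,
  `AreaLawOnBallC N d β κ ε₀ ε₁`, is FALSE for every `N ≥ 2`, `d ≥ 2`, `β`, `κ`, `ε₀ > 0`, `ε₁ > 0` (perimeter-size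
  loop terms are members and screen their own loop); the honest tier-2 area law keeps a vertical window.
WHAT THIS IS NOT: no continuum statement, no clustering rate beyond the displayed ones / `∃ m > 0`, no spectral
gap, no tier-2 AREA LAW (T28 refutes the window-free one), nothing about perturbations merely small in sup-norm,
no claim on the Yang–Mills Millennium problem.
-/

noncomputable section

namespace Summit.Ventures.YMGap

open Literature.Probability.LatticeModels (HasExponentialDecay Potential)
open Literature.MathematicalPhysics.QuantumLattice (fundamentalRep plaquetteCorrFn ZdEdge)
open Literature.Barriers.QuantumFields (IsMassiveState)
open Summit.Ventures.YMGap.RobustBall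

/-- **T22 — track Y2: `SU(2)`, `d = 4`, the MASS GAP UNIFORMLY ON THE TIER-1 `ℤ⁴` BALL, HYPOTHESIS-FREE** (Wilson
`β_W`; 't Hooft `β_W/4`, tree coupling `β_W/2`): (i) for every `β_W, ε₀, ε₁, R` with
`6|β_W| e^{ε₀} + e^{ε₀/2} √(2/3) ε₁ < 1`, `MassGapOnBallZd 4 2 (β_W/4) ε₀ ε₁ R` — EVERY member `(W, supp)` of
`MemBallZd ε₀ ε₁ R` added to the `SU(2)` Wilson action at `β_W` has exactly one DLR state, exponentially clustering
(`RobustBall.su2_massGapOnBallZd_dim4`; one-link input: the sharp Poincaré constant `2/3`; at `ε₀ = ε₁ = 0` the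
Wilson window `|β_W| < 1/6`); (ii) under the same door every member HAS DLR states and EVERY one of them is MASSIVE
(`IsMassiveState`: one rate for all truncated correlations of bounded measurable local observables) with
exponentially decaying plaquette–plaquette correlation function (`RobustBall.su2_massive_onBallZd_dim4`);
(iii) the certified rows of record, radii `(ε₀, ε₁) = (2ε, ε)`, every range `R`: `(β_W, ε) = (1/8, 143/1000)`,
`(1/6, 49/1000)` (sharp-variance door, `RobustBall.su2_rowB_1_8/_1_6`) and `(1/16, 147/500)` (`RobustBall.su2_rowA_1_16`).
Strong-coupling lattice statements; the radii are door artefacts. -/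
def T22_SU2BallMassGap : Prop :=
  (∀ βW ε₀ ε₁ R : ℝ, 6 * |βW| * Real.exp ε₀ + Real.exp (ε₀ / 2) * Real.sqrt (2 / 3) * ε₁ < 1 →
      MassGapOnBallZd 4 2 (βW / 4) ε₀ ε₁ R) ∧
    (∀ βW ε₀ ε₁ R : ℝ, 6 * |βW| * Real.exp ε₀ + Real.exp (ε₀ / 2) * Real.sqrt (2 / 3) * ε₁ < 1 →
      ∀ (W : Potential (ZdEdge 4) (Matrix.specialUnitaryGroup (Fin 2) ℂ))
        (supp : Finset (ZdEdge 4) → Finset (Finset (ZdEdge 4))), MemBallZd ε₀ ε₁ R W supp →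
        (perturbedGibbsMeasures (d := 4) (fundamentalRep (Fin 2)) (((2 : ℕ) : ℝ) * (βW / 4)) W supp).Nonempty ∧
          ∀ μ ∈ perturbedGibbsMeasures (d := 4) (fundamentalRep (Fin 2)) (((2 : ℕ) : ℝ) * (βW / 4)) W supp,
            IsMassiveState μ ∧ HasExponentialDecay (plaquetteCorrFn (fundamentalRep (Fin 2)) μ)) ∧
    (∀ R : ℝ, MassGapOnBallZd 4 2 ((1 / 8 : ℝ) / 4) (2 * (143 / 1000)) (143 / 1000) R ∧
      MassGapOnBallZd 4 2 ((1 / 6 : ℝ) / 4) (2 * (49 / 1000)) (49 / 1000) R ∧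
      MassGapOnBallZd 4 2 ((1 / 16 : ℝ) / 4) (2 * (147 / 500)) (147 / 500) R)

/-- T22 holds (`RobustBall.su2_massGapOnBallZd_dim4`, `RobustBall.su2_massive_onBallZd_dim4`,
`RobustBall.su2_rowB_1_8`, `RobustBall.su2_rowB_1_6`, `RobustBall.su2_rowA_1_16`). -/
theorem T22_SU2BallMassGap_holds : T22_SU2BallMassGap :=
  ⟨fun _ _ _ R hρ => su2_massGapOnBallZd_dim4 R hρ,
    fun _ _ _ R hρ _ _ hmem => su2_massive_onBallZd_dim4 R hρ hmem,
    fun R => ⟨su2_rowB_1_8 R, su2_rowB_1_6 R, su2_rowA_1_16 R⟩⟩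

/-- **T23 — track Y2: the CONVERSION on the ball, every `N ≥ 1`, `d = 4`, HYPOTHESIS-FREE**: at every 't Hooft
coupling `β` and radii `(ε₀, ε₁, R)` where `MassGapOnBallZd 4 N β ε₀ ε₁ R` holds, EVERY member `(W, supp)` of the
tier-1 `ℤ⁴` ball `MemBallZd ε₀ ε₁ R` added to `N β S_W` has DLR states, and every DLR state of the member is MASSIVE
with exponentially decaying plaquette–plaquette correlation function
(`RobustBall.massive_onBallZd_of_massGapOnBallZd`; text typed by seat ds-3). -/
def T23_BallMassiveConversion : Prop :=
  ∀ N : ℕ, 1 ≤ N → ∀ β ε₀ ε₁ R : ℝ, MassGapOnBallZd 4 N β ε₀ ε₁ R →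
    ∀ (W : Potential (ZdEdge 4) (Matrix.specialUnitaryGroup (Fin N) ℂ))
      (supp : Finset (ZdEdge 4) → Finset (Finset (ZdEdge 4))), MemBallZd ε₀ ε₁ R W supp →
      (perturbedGibbsMeasures (d := 4) (fundamentalRep (Fin N)) ((N : ℝ) * β) W supp).Nonempty ∧
        ∀ μ ∈ perturbedGibbsMeasures (d := 4) (fundamentalRep (Fin N)) ((N : ℝ) * β) W supp,
          IsMassiveState μ ∧ HasExponentialDecay (plaquetteCorrFn (fundamentalRep (Fin N)) μ)

/-- T23 holds (`RobustBall.massive_onBallZd_of_massGapOnBallZd`). -/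
theorem T23_BallMassiveConversion_holds : T23_BallMassiveConversion :=
  fun _ hN _ _ _ _ h _ _ hmem => massive_onBallZd_of_massGapOnBallZd hN h hmem

/-- **T24 — track Y2: `N ≥ 3` on the tier-1 `ℤ⁴` ball, `d = 4`, HYPOTHESIS-FREE**: (i) for EVERY `N ≥ 2` and
every range `R`, `MassGapOnBallZd 4 N (1/64) (1/10) (1/10) R` — 't Hooft `1/64` (three quarters of Shen–Zhu–Zhu's
Wilson window `1/48`), radii `(ε₀, ε₁) = (1/10, 1/10)` (NOT the `(2ε, ε)` convention), Bakry–Émery one-link pair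
(`RobustBallSUN.suN_massGapOnBallZd_bakryEmery_dim4_row`, seat p2); (ii) `SU(3)` (tree coupling `β_W/3`,
't Hooft `β_W/9`), radii `(2ε, ε)`, every `R`: `(β_W, ε) = (1/10, 23/100)`, `(1/8, 4/25)`, `(1/6, 1/20)`
(`RobustBallSU3.su3_freeZdRow_1_10/_1_8/_1_6`, seat engine-2; the larger rows on the two certified one-link
constants of T19 are conditional and not restated here). -/
def T24_SUNBallRows : Prop :=
  (∀ N : ℕ, 2 ≤ N → ∀ R : ℝ, MassGapOnBallZd 4 N (1 / 64) (1 / 10) (1 / 10) R) ∧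
    (∀ R : ℝ, MassGapOnBallZd 4 3 ((1 / 10 : ℝ) / 9) (2 * (23 / 100)) (23 / 100) R ∧
      MassGapOnBallZd 4 3 ((1 / 8 : ℝ) / 9) (2 * (4 / 25)) (4 / 25) R ∧
      MassGapOnBallZd 4 3 ((1 / 6 : ℝ) / 9) (2 * (1 / 20)) (1 / 20) R)

/-- T24 holds (`RobustBallSUN.suN_massGapOnBallZd_bakryEmery_dim4_row`, `RobustBallSU3.su3_freeZdRow_1_10`,
`RobustBallSU3.su3_freeZdRow_1_8`, `RobustBallSU3.su3_freeZdRow_1_6`). -/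
theorem T24_SUNBallRows_holds : T24_SUNBallRows :=
  ⟨fun _ hN R => RobustBallSUN.suN_massGapOnBallZd_bakryEmery_dim4_row hN R,
    fun R => ⟨RobustBallSU3.su3_freeZdRow_1_10 R, RobustBallSU3.su3_freeZdRow_1_8 R,
      RobustBallSU3.su3_freeZdRow_1_6 R⟩⟩

/-- **T25 — track Y2: `SU(2)`, `d = 4`, EXPONENTIAL CLUSTERING UNIFORM IN THE TORUS `(ℤ/L)⁴`, `L ≥ 3`, ON THE
TORUS BALLS, HYPOTHESIS-FREE** (tree coupling `β_W/2`; `TorusClusteringOnBall(W)`: ONE constant `16` and ONE rate for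
every torus, every member, every pair of bounded Lipschitz local gauge observables; `rhoFR` = the received row sum
of the quarter one-link door): (i) tier 1: for `0 < β_W ≤ 2/3`, `0 ≤ ε₀, ε₁`, every range `r`,
`rhoFR 2 (9β_W/2) ε₀ ε₁ < 1 ⇒ TorusClusteringOnBall 2 4 (β_W/2) ε₀ ε₁ r 16 (−log(rhoFR 2 (9β_W/2) ε₀ ε₁)/(r ⊔ 1))`
(`RobustBall.su2_torusClusteringOnBall_quarter`); (ii) the row of record `(β_W, ε) = (1/8, 13/100)`, radii
`(13/50, 13/100)`, every range `r` (`RobustBall.su2_torusClusteringOnBall_oneEighth_quarter`); (iii) tier 2 (no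
range cut-off, loads weighted by `e^{κ·diam}`, `κ ≥ 0`): `rhoFR 2 (e^{κ}·9β_W/2) ε₀ ε₁ < 1 ⇒
TorusClusteringOnBallW 2 4 (β_W/2) κ ε₀ ε₁ 16 κ` (`RobustBall.su2_torusClusteringOnBallW_quarter`); (iv) the tier-2
row `(β_W, κ, ε) = (1/8, log(6/5), 43/500)`: rate `log(6/5)` per lattice unit
(`RobustBall.su2_torusClusteringOnBallW_oneEighth_w65`). Texts: seat ds-2. SITE-incidence balls. -/
def T25_SU2TorusBallClustering : Prop :=
  (∀ βW ε₀ ε₁ : ℝ, 0 < βW → βW ≤ 2 / 3 → 0 ≤ ε₀ → 0 ≤ ε₁ → ∀ r : ℕ, rhoFR 2 (9 / 2 * βW) ε₀ ε₁ < 1 →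
      TorusClusteringOnBall 2 4 (βW / 2) ε₀ ε₁ r 16 (-Real.log (rhoFR 2 (9 / 2 * βW) ε₀ ε₁) / max r 1)) ∧
    (∀ r : ℕ, TorusClusteringOnBall 2 4 (1 / 16) (13 / 50) (13 / 100) r 16
      (-Real.log (rhoFR 2 (9 / 16) (13 / 50) (13 / 100)) / max r 1)) ∧
    (∀ βW κ ε₀ ε₁ : ℝ, 0 < βW → βW ≤ 2 / 3 → 0 ≤ κ → 0 ≤ ε₀ → 0 ≤ ε₁ →
      rhoFR 2 (Real.exp κ * (9 / 2 * βW)) ε₀ ε₁ < 1 → TorusClusteringOnBallW 2 4 (βW / 2) κ ε₀ ε₁ 16 κ) ∧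
    TorusClusteringOnBallW 2 4 (1 / 16) (Real.log (6 / 5)) (43 / 250) (43 / 500) 16 (Real.log (6 / 5))

/-- T25 holds (`RobustBall.su2_torusClusteringOnBall_quarter`, `RobustBall.su2_torusClusteringOnBall_oneEighth_quarter`,
`RobustBall.su2_torusClusteringOnBallW_quarter`, `RobustBall.su2_torusClusteringOnBallW_oneEighth_w65`). -/
theorem T25_SU2TorusBallClustering_holds : T25_SU2TorusBallClustering :=
  ⟨fun _ _ _ hβ0 hβ hε₀ hε₁ r hρ1 => su2_torusClusteringOnBall_quarter hβ0 hβ hε₀ hε₁ r hρ1,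
    su2_torusClusteringOnBall_oneEighth_quarter,
    fun _ _ _ _ hβ0 hβ hκ hε₀ hε₁ hρ1 => su2_torusClusteringOnBallW_quarter hβ0 hβ hκ hε₀ hε₁ hρ1,
    su2_torusClusteringOnBallW_oneEighth_w65⟩

/-- **T26 — track Y2: `SU(2)`, `d = 4`, the WILSON AREA LAW UNIFORMLY ON THE TORUS BALL, HYPOTHESIS-FREE** (tree
coupling `β_W/2`; `AreaLawOnBall 2 4 β ε₀ ε₁ r mv`: constants `C, c > 0` with `|⟨W_{R×T}⟩| ≤ C^{2(R+T)} e^{−cRT}` for every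
torus, every member of `ClusterDomainFR ε₀ ε₁ r` that is slab-local with vertical window `mv`, every rectangle with
`2R, 2T ≤ L`; robust Durhuus–Fröhlich slab criterion + quarter slab door): (i) for `0 ≤ β_W`, `3β_W/2 ≤ 1`, `0 ≤ ε₁`,
every `r`, every `mv ≥ 1`: `e^{ε₀}(1 + 2√2 ε₁)(3β_W/2) + √2 ε₁ < 1 ⇒ AreaLawOnBall 2 4 (β_W/2) ε₀ ε₁ r mv`
(`RobustBall.su2_areaLawOnBall_of_row`); (ii) the rows of record `(β_W; ε₀, ε₁) = (1/3; 1/5, 1/10)` and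
`(1/2; 2/25, 1/25)`, every `r`, every `mv ≥ 1` (`RobustBall.su2_areaLawOnBall_oneThird/_oneHalf`; printed Wilson
threshold `1/6`, the cell's Wilson record `β_W < 2/3` = T5). Texts: seat rb-p2. No tier-2 area law is claimed (T28). -/
def T26_SU2BallAreaLaw : Prop :=
  (∀ βW ε₀ ε₁ : ℝ, 0 ≤ βW → 3 * βW / 2 ≤ 1 → 0 ≤ ε₁ → ∀ (r mv : ℕ), 1 ≤ mv →
      Real.exp ε₀ * (1 + 2 * Real.sqrt 2 * ε₁) * (3 * βW / 2) + Real.sqrt 2 * ε₁ < 1 →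
        AreaLawOnBall 2 4 (βW / 2) ε₀ ε₁ r mv) ∧
    (∀ (r mv : ℕ), 1 ≤ mv →
      AreaLawOnBall 2 4 (1 / 6) (1 / 5) (1 / 10) r mv ∧ AreaLawOnBall 2 4 (1 / 4) (2 / 25) (1 / 25) r mv)

/-- T26 holds (`RobustBall.su2_areaLawOnBall_of_row`, `RobustBall.su2_areaLawOnBall_oneThird`,
`RobustBall.su2_areaLawOnBall_oneHalf`). -/
theorem T26_SU2BallAreaLaw_holds : T26_SU2BallAreaLaw :=
  ⟨fun _ _ _ hβ hβ1 h₁ r _ hmv hrow => su2_areaLawOnBall_of_row hβ hβ1 h₁ r hmv hrow,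
    fun r _ hmv => ⟨su2_areaLawOnBall_oneThird r hmv, su2_areaLawOnBall_oneHalf r hmv⟩⟩

/-- **T27 — track Y2: `SU(2)`, `d = 4`, the MASS GAP UNIFORMLY ON THE TIER-2 `ℤ⁴` BALL (NO RANGE CUT-OFF),
HYPOTHESIS-FREE** ('t Hooft `β_W/4`; `MassGapOnBallZdS 4 2 β a Λ t`: every member of `MemBallZdS a Λ t` — summable
continuous link potential, oscillation load `≤ a`, diagonal-free cross-Lipschitz load weighted by `e^{t‖e−y‖_∞}`
`≤ Λ` — has exactly one DLR state, exponentially clustering): (i) for every `β_W, a, Λ` and every `t > 0`,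
`6|β_W| e^{a} e^{t} + e^{a/2} √(2/3) Λ < 1 ⇒ MassGapOnBallZdS 4 2 (β_W/4) a Λ t` (`RobustBall.su2_massGapOnBallZdS_dim4`);
(ii) rows of record, loads `(2ε, ε)`: at weight `e^{t} = 2`, `(β_W, ε) = (1/16, 97/1000)` (`RobustBall.su2_rowS2_1_16`)
and `(1/16, 143/1000)` on the sharp-variance door (`RobustBall.su2_rowBS2_1_16`); at weight `e^{t} = 3/2`,
`(1/16, 93/500)` (`RobustBall.su2_rowS32_1_16`). Scaling identity of the door: the tier-2 row at `β_W` and weight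
`q` is the tier-1 row at `qβ_W`. Texts: seat rb-p1. -/
def T27_SU2TierTwoBallMassGap : Prop :=
  (∀ βW a Λ t : ℝ, 0 < t →
      6 * |βW| * (Real.exp a * Real.exp t) + Real.exp (a / 2) * Real.sqrt (2 / 3) * Λ < 1 →
        MassGapOnBallZdS 4 2 (βW / 4) a Λ t) ∧
    MassGapOnBallZdS 4 2 ((1 / 16 : ℝ) / 4) (2 * (97 / 1000)) (97 / 1000) (Real.log 2) ∧
    MassGapOnBallZdS 4 2 ((1 / 16 : ℝ) / 4) (2 * (143 / 1000)) (143 / 1000) (Real.log 2) ∧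
    MassGapOnBallZdS 4 2 ((1 / 16 : ℝ) / 4) (2 * (93 / 500)) (93 / 500) (Real.log (3 / 2))

/-- T27 holds (`RobustBall.su2_massGapOnBallZdS_dim4`, `RobustBall.su2_rowS2_1_16`, `RobustBall.su2_rowBS2_1_16`,
`RobustBall.su2_rowS32_1_16`). -/
theorem T27_SU2TierTwoBallMassGap_holds : T27_SU2TierTwoBallMassGap :=
  ⟨fun _ _ _ _ ht hρ => su2_massGapOnBallZdS_dim4 ht hρ, su2_rowS2_1_16, su2_rowBS2_1_16, su2_rowS32_1_16⟩

/-- **T28 — track Y2, NEGATIVE: NO AREA LAW UNIFORM ON THE TIER-2 TORUS BALL UNDER CENTRE-SLAB INVARIANCE ALONE**: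
for every `N ≥ 2`, `d ≥ 2`, every coupling `β`, every weight `κ` and all radii `ε₀ > 0`, `ε₁ > 0`,
`¬ AreaLawOnBallC N d β κ ε₀ ε₁` — the strengthening of T26's currency that drops the vertical dependence window and
keeps only invariance of the total perturbation under centre rotations of one slab of vertical links is REFUTED:
fundamental Wilson-loop terms of perimeter size are members of `ClusterDomain κ ε₀ ε₁` and screen their own loop
(perimeter decay). The honest tier-2 area law keeps the vertical window (`AreaLawOnBallW … mv`, not claimed here).
(`RobustBall.not_areaLawOnBallC`, seat lit-1.) -/
def T28_TierTwoAreaLawNoGo : Prop :=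
  ∀ N d : ℕ, 2 ≤ N → 2 ≤ d → ∀ β κ ε₀ ε₁ : ℝ, 0 < ε₀ → 0 < ε₁ → ¬ AreaLawOnBallC N d β κ ε₀ ε₁

/-- T28 holds (`RobustBall.not_areaLawOnBallC`). -/
theorem T28_TierTwoAreaLawNoGo_holds : T28_TierTwoAreaLawNoGo :=
  fun _ _ hN hd β κ _ _ hε₀ hε₁ => not_areaLawOnBallC hN hd β κ hε₀ hε₁

end Summit.Ventures.YMGap

end
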